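import Summits.QuantumFields.BalabanUV.Beta.GAN24.VolumeLimitCovariance
import Summits.QuantumFields.BalabanUV.Beta.GAN24.VolumeLimitInverse

/-!
# `BalabanUV.Beta.GAN24.EffectiveFormVolumeLimit` — binder row G-an2-4 ∕ (CONV-C), route R7 «TWO CURRENCIES», PART 139: THE ONE DISPLAYED HYPOTHESIS OF PART 134 DISCHARGED —
# `LimitForm.conv`'s CLAUSE ON `ℤ^d` FOR THE EFFECTIVE FORM `Σ_k = (Q_k𝒢Q_kᴴ)⁻¹ − a·1` AT `U = 1`, UNCONDITIONALLY (`d ≥ 3`, `L ≥ 2`, `a > 0`, `μ ≠ ν`, along the even cubic volumes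
# `side t = 2(t+1)`): PART 138's (α) (β) (γ) + shift invariance ⟹ PART 137's `exists_isInfiniteVolumeLimit_inv_sub_re` ⟹ `∃ Π_k, IsInfiniteVolumeLimit evenPeriod (Re Σ^{(2(t+1))}_k(e(·,μ′),e(0,ν′))) Π_k`
# for every level `k` ⟹ PART 134's `conv_effForm_of_isInfiniteVolumeLimit` with NOTHING displayed: `UniformDecay Π`, `StepRate Π (√(L⁻¹))`, `KernelInputs d Π` inhabited, and
# `|secondMoment (Π k) μ ν − secondMoment Π_∞ μ ν| ≤ c₀·(√(L⁻¹))^k` — the literal `conv` field of `Beta.Assembly.LimitForm` for these kernels (unit b2b-balaban-gan24-p3, gen 54; v1)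

NOT IN PRINT; OUR PROOF ([folklore] bookkeeping BY NAME over PARTs 134, 137, 138 and the β-cell's `Beta.BlockKernelVolumeSockets.tendsto_evenPeriod`).  [Balaban1987RG1] (1.21)–(1.22) p. 264
LOCATE the shapes («Now we take a limit of these functions as T^{(j+1)} ↗ Z^d. This limit exists by the localized representation (1.7).»); nothing printed is a hypothesis.
HONEST FRAMING (cell contract, verbatim): «discharging `BetaPertH` makes Bałaban's UV stability UNCONDITIONAL — a real constructive-QFT result; it is NOT the
continuum limit and NOT the Clay problem.»  HONEST DEPENDENCY (verbatim): «continuum YM on T⁴ ⇐ BetaPertH ∧ nine spine estimates (0/9 proved); BetaPertH ⇐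
(D1) ∧ (D4) ∧ CAP+tail; G-an2-4 gates asym, D1 and NE2/3/4.»

WHAT THIS FILE PROVES (0 sorry, 0 `def`):
* **`isInfiniteVolumeLimit_effForm`** (`d ≥ 3`, every `L ≥ 1`, `a > 0`, `k`): `∃ Π_k : B12Beta.Kernel d, IsInfiniteVolumeLimit evenPeriod (t μ′ ν′ z ↦ Re (c_k⁻¹ − a·1)(e(z,μ′), e(0,ν′))) Π_k`
  on the cubic tori `cubic d (evenPeriod t)` — the hypothesis `∀ k, IsInfiniteVolumeLimit side (P k) (Π k)` of PART 134 along `side = evenPeriod`.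
* **`conv_effForm`** — THE END, UNCONDITIONAL (`L ≥ 2`, `d ≥ 3`, `μ ≠ ν`): `∃ δ₀ > 0, C, C′ ≥ 0, Π : ℕ → Kernel d` with `∀ k, IsInfiniteVolumeLimit evenPeriod (P k) (Π k)`,
  `Beta.LimitRate.UniformDecay Π μ ν C δ₀`, `StepRate Π μ ν C′ δ₀ (√(L⁻¹))`, `∃ K : KernelInputs d Π` (`K.θ = √(L⁻¹)`, `K.c₀ = β′_d(C′∕(1−√(L⁻¹)), δ₀)`, `K.Pinf = limKernelOf Π`), and
  `∀ k, |secondMoment (Π k) μ ν − secondMoment (limKernelOf Π) μ ν| ≤ β′_d(C′∕(1−√(L⁻¹)), δ₀)·(√(L⁻¹))^k`.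
READING (numbers, not adjectives): for the lineage's effective form `Σ_k` at `U = 1` the chain PART 115 → … → 139 now runs from the tree's definitions to the β-cell's `LimitRate` ∕ `KernelInputs`
currency on `ℤ^d` with NO displayed binder: (CONV-C)'s two clauses, the `T ↗ ℤ^d` limits and `LimitForm.conv`'s literal shape, for THIS constituent.  WHAT IT IS NOT: Bałaban's `Π⁰_{k+1}`
(row an1's vertex dictionary — `Σ_k` is the (1.65)-dictionary effective form), `U ≠ 1`, odd ∕ non-cubic volumes, `d ≤ 2`, any identification of `Π_∞`.  SUPPLIER work; no consumer of record;
NEVER «G-an2-4 closed»; NOT (CONV-C), NOT D1, NOT `BetaPertH`, NOT continuum, NOT Clay.  Records: `HOME/b2b-balaban-gan24-p3/gen54/README.md`.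
-/

noncomputable section

open scoped BigOperators ComplexConjugate Matrix Matrix.Norms.L2Operator
open Filter Topology

namespace Summit.QuantumFields.BalabanUV.Beta.GAN24.EffectiveFormVolumeLimit

open Literature.MathematicalPhysics.QuantumFieldTheory.Balaban1983to89
open Literature.MathematicalPhysics.QuantumFieldTheory.Balaban1983to89.B5Prop11Plancherel (Tor fine)
open Literature.MathematicalPhysics.QuantumFieldTheory.Balaban1983to89.B12Sec2to5 (betaPrime510)
open Literature.MathematicalPhysics.QuantumFieldTheory.Balaban1983to89.Beta (Site windowMap IsInfiniteVolumeLimit)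
open Literature.MathematicalPhysics.QuantumFieldTheory.Balaban1983to89.Beta.FreeLegDictionary (cubic)
open Literature.MathematicalPhysics.QuantumFieldTheory.Balaban1983to89.Beta.BlockKernelVolumeSockets (evenPeriod tendsto_evenPeriod)
open Literature.MathematicalPhysics.QuantumFieldTheory.Balaban1983to89.Beta.VectorTails (castT)
open Literature.MathematicalPhysics.QuantumFieldTheory.Balaban1983to89.Beta.LimitRate (StepRate limKernelOf KernelInputs)
open Summit.QuantumFields.BalabanUV.T4Continuum
open Summit.QuantumFields.BalabanUV.T4Continuum.BalabanAveragedTowerUnit (idx unitCovB)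
open Summit.QuantumFields.BalabanUV.T4Continuum.BalabanAveragedCoerciveTower (unitIdx)
open Summit.QuantumFields.BalabanUV.Beta.GAN24.DiagramDecayWindow (conv_effForm_of_isInfiniteVolumeLimit)
open Summit.QuantumFields.BalabanUV.Beta.GAN24.VolumeLimitInverse (exists_isInfiniteVolumeLimit_inv_sub_re)
open Summit.QuantumFields.BalabanUV.Beta.GAN24.VolumeLimitCovariance (exists_windowDecay_unitCovB tendsto_reindex_unitCovB opNorm_one_sub_smul_unitCovB_le
  one_sub_gammaB_div_Cst_lt_one reindex_unitCovB_shift reindex_inv_sub_smul_one_apply)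

variable {d : ℕ} (L : ℕ) [NeZero L] (a : ℝ) (ha : 0 < a)

/-! ## The infinite-volume limits of the effective form, and PART 134's END made unconditional -/

/-- **`isInfiniteVolumeLimit_effForm` — THE ONE DISPLAYED HYPOTHESIS OF PART 134, DISCHARGED** (`d ≥ 3`, every `L ≥ 1`, `a > 0`, every level `k`): along the even cubic volumes
`side t = 2(t+1)` the real parts of the entries of the effective form `Σ_k = c_k⁻¹ − a·1` read from the origin HAVE an infinite-volume limit kernel in the β-cell's sense:
`∃ Π_k, IsInfiniteVolumeLimit evenPeriod (t μ ν z ↦ Re Σ^{(2(t+1))}_k(e(z,μ), e(0,ν))) Π_k` — PART 137's `exists_isInfiniteVolumeLimit_inv_sub_re` on PART 138 (α), (β), (γ) and the shift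
invariance of PART 138. [cite: Balaban1987RG1, p.264 (after (1.21))] -/
theorem isInfiniteVolumeLimit_effForm (hd : 3 ≤ d) (k : ℕ) :
    ∃ Pinf : B12Beta.Kernel d, IsInfiniteVolumeLimit evenPeriod
      (fun t μ' ν' (z : Site d (evenPeriod t)) => (((unitCovB L (cubic d (evenPeriod t)) a ha k)⁻¹
          - (a : ℂ) • (1 : Matrix (idx L (cubic d (evenPeriod t)) 0) (idx L (cubic d (evenPeriod t)) 0) ℂ))
        ((unitIdx L (cubic d (evenPeriod t))).symm (z, μ')) ((unitIdx L (cubic d (evenPeriod t))).symm (0, ν'))).re) Pinf := by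
  have hd1 : 1 ≤ d := le_trans (by norm_num) hd
  obtain ⟨κ, B, hκ, hB, hdec⟩ := exists_windowDecay_unitCovB L a ha
  have hδ : 0 < κ / d := div_pos hκ (by exact_mod_cast lt_of_lt_of_le zero_lt_one hd1)
  have hlim' := fun μ ν z => tendsto_reindex_unitCovB L a ha hd k μ ν z
  choose Kc hKc using hlim'
  obtain ⟨Pinf, hP⟩ := exists_isInfiniteVolumeLimit_inv_sub_re (d := d) tendsto_evenPeriod
    (A := fun t => Matrix.reindex (unitIdx L (cubic d (evenPeriod t))) (unitIdx L (cubic d (evenPeriod t))) (unitCovB L (cubic d (evenPeriod t)) a ha k))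
    (fun t => opNorm_one_sub_smul_unitCovB_le L (cubic d (evenPeriod t)) a ha hd1 k) (one_sub_gammaB_div_Cst_lt_one a ha)
    (fun t x μ y ν v => reindex_unitCovB_shift L (cubic d (evenPeriod t)) a ha k x μ y ν v)
    (fun t μ ν w => hdec (evenPeriod t) k μ ν w) hδ (Kinf := Kc) (fun μ ν x => hKc μ ν x) (a : ℂ)
  refine ⟨Pinf, ?_⟩
  have e : (fun t μ' ν' (z : Site d (evenPeriod t)) => (((Matrix.reindex (unitIdx L (cubic d (evenPeriod t))) (unitIdx L (cubic d (evenPeriod t)))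
        (unitCovB L (cubic d (evenPeriod t)) a ha k))⁻¹ - (a : ℂ) • (1 : Matrix (Site d (evenPeriod t) × Fin d) (Site d (evenPeriod t) × Fin d) ℂ)) (z, μ') (0, ν')).re)
      = (fun t μ' ν' (z : Site d (evenPeriod t)) => (((unitCovB L (cubic d (evenPeriod t)) a ha k)⁻¹
          - (a : ℂ) • (1 : Matrix (idx L (cubic d (evenPeriod t)) 0) (idx L (cubic d (evenPeriod t)) 0) ℂ))
        ((unitIdx L (cubic d (evenPeriod t))).symm (z, μ')) ((unitIdx L (cubic d (evenPeriod t))).symm (0, ν'))).re) := by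
    funext t μ' ν' z
    rw [reindex_inv_sub_smul_one_apply]
  rw [← e]
  exact hP

/-- **`conv_effForm` — `LimitForm.conv`'s CLAUSE ON `ℤ^d` FOR THE EFFECTIVE FORM `Σ_k` AT `U = 1`, UNCONDITIONALLY** [our proof] (`L ≥ 2`, `d ≥ 3`, `μ ≠ ν`, `a > 0`): there are `δ₀ > 0`,
`C, C′ ≥ 0` (from `(d, L, a)`) and limit kernels `Π : ℕ → B12Beta.Kernel d` such that, along the even cubic volumes `side t = 2(t+1)`, every `Π_k` IS the infinite-volume limit of
`Re Σ^{(side t)}_k(e(·,μ′), e(0,ν′))` (`isInfiniteVolumeLimit_effForm`), `Beta.LimitRate.UniformDecay Π μ ν C δ₀`, `StepRate Π μ ν C′ δ₀ (√(L⁻¹))`, `KernelInputs d Π` is inhabited with `θ = √(L⁻¹)`, and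
`∀ k, |secondMoment (Π k) μ ν − secondMoment (limKernelOf Π) μ ν| ≤ β′_d(C′∕(1−√(L⁻¹)), δ₀)·(√(L⁻¹))^k` — PART 134's `conv_effForm_of_isInfiniteVolumeLimit` with its one displayed
hypothesis supplied by `isInfiniteVolumeLimit_effForm`.  NOTHING DISPLAYED REMAINS for this object.  (`Σ_k` is the (1.65)-dictionary effective form at `U = 1`, NOT Bałaban's `Π⁰_{k+1}`.)
[cite: Balaban1987RG1, (1.21)–(1.22) p.264 (shapes)] -/
theorem conv_effForm (hL : 2 ≤ L) (hd : 3 ≤ d) {μ ν : Fin d} (hne : μ ≠ ν) :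
    ∃ δ₀ C C' : ℝ, 0 < δ₀ ∧ 0 ≤ C ∧ 0 ≤ C' ∧ ∃ Pinf : ℕ → B12Beta.Kernel d,
      (∀ k, IsInfiniteVolumeLimit evenPeriod
        (fun t μ' ν' (z : Site d (evenPeriod t)) => (((unitCovB L (cubic d (evenPeriod t)) a ha k)⁻¹
            - (a : ℂ) • (1 : Matrix (idx L (cubic d (evenPeriod t)) 0) (idx L (cubic d (evenPeriod t)) 0) ℂ))
          ((unitIdx L (cubic d (evenPeriod t))).symm (z, μ')) ((unitIdx L (cubic d (evenPeriod t))).symm (0, ν'))).re) (Pinf k)) ∧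
      Beta.LimitRate.UniformDecay Pinf μ ν C δ₀ ∧ StepRate Pinf μ ν C' δ₀ (Real.sqrt ((L : ℝ)⁻¹)) ∧
      (∃ K : KernelInputs d Pinf, K.θ = Real.sqrt ((L : ℝ)⁻¹) ∧ K.c₀ = betaPrime510 d (C' / (1 - Real.sqrt ((L : ℝ)⁻¹))) δ₀ ∧ K.Pinf = limKernelOf Pinf ∧ K.μ = μ ∧ K.ν = ν) ∧
      (∀ k, |B12Beta.secondMoment (Pinf k) μ ν - B12Beta.secondMoment (limKernelOf Pinf) μ ν|
          ≤ betaPrime510 d (C' / (1 - Real.sqrt ((L : ℝ)⁻¹))) δ₀ * Real.sqrt ((L : ℝ)⁻¹) ^ k) := by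
  obtain ⟨δ₀, C, C', hδ₀, hC, hC', h⟩ := conv_effForm_of_isInfiniteVolumeLimit L a ha hL (le_trans (by norm_num) hd) hne
  have hlim := fun k => isInfiniteVolumeLimit_effForm L a ha hd k
  choose Pinf hPinf using hlim
  exact ⟨δ₀, C, C', hδ₀, hC, hC', Pinf, hPinf, h evenPeriod tendsto_evenPeriod Pinf hPinf⟩


end Summit.QuantumFields.BalabanUV.Beta.GAN24.EffectiveFormVolumeLimit

end
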